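import Summits.MatrixMultiplication.OmegaCensus.STPPSmallPatternCriteria

/-!
# ω-census, small STPP pattern `(2,1,1)^k`: the SHIFTED-PAIRS model of engine γ IS Def. 5.1 (kernel criterion + its symmetries)

HONEST FRAMING (pub-omega census; verbatim): lottery ticket; floor = certified bounds/negative ranges.
Census STRUCTURE tool of the STPP track (seat pub-omega ENG2, gen 35; STRUCTURE row B5, the threshold column
`T1(H) = max {k : (2,1,1)^k ⊆ H}`), not progress on `ω`: small patterns in small groups bound no exponent.

ENG2's engine γ ("C-first coloured clique", HOME `pub-omega-eng2-g35/…/clq.c`; the complete NONE verdicts for `(2,1,1)⁷` at every abelian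
type of order `30–37` and the `r_8` window job) does not search Def. 5.1 literally.  It fixes the `k` points `cᵢ` first and then looks for
`2k` pairwise distinct points `xᵢ, yᵢ` (the SHIFTED PAIRS `Xᵢ = Aᵢ − cᵢ`) subject to the single law
`(Xᵢ + cᵢ − cⱼ) ∩ X_l = ∅` for every index triple `(i, j, l)` other than `i = j = l`.  This file puts into the kernel that this model is
EXACTLY the tree's difference model `exists_isSTPP_211_iff` (`STPPSmallPatternCriteria.lean`), hence exactly CKSU Def. 5.1 (tree `IsSTPP`)
for the size pattern `(2,1,1)^k` — so that the only trusted part of the mirror is its search, as for the listers of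
`STPPSmallPatternCriteria.lean`:

* `ShiftPairs211 x y c` — the model (a `Prop` on three maps `Fin k → H`);
* `shiftPairs211_iff_pairPoint` — substitution `pᵢ = xᵢ + cᵢ`, `qᵢ = yᵢ + cᵢ` turns it into the difference model and back;
* `exists_isSTPP_211_iff_shiftPairs` — **`H` hosts the size pattern `(2,1,1)^k` iff some `x y c` satisfy `ShiftPairs211`**;
* the SYMMETRIES the engine quotients by, as kernel facts: translating all `xᵢ, yᵢ` by one `t` (`ShiftPairs211.add_left`), translating
  all `cᵢ` by one `t` (`ShiftPairs211.add_right`), an injective additive map applied to everything (`ShiftPairs211.map`), and relabelling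
  the indices (`ShiftPairs211.comp_equiv`).  (The engine's normal form: `0 ∈ C`, `C` lex-minimal among its images under translations and
  listed automorphisms, `0 ∈ X`.)

No threshold or existence claim is made here.  References: H. Cohn, R. Kleinberg, B. Szegedy, C. Umans, *Group-theoretic algorithms for
matrix multiplication*, FOCS 2005 (arXiv:math/0511460), Def. 5.1.
-/

namespace Summit.MatrixMultiplication.OmegaCensus

open Finset Literature.Computability.AlgebraicComplexity

variable {H : Type*} [AddCommGroup H] {k : ℕ}

/-- ENGINE γ's SHIFTED-PAIRS MODEL of a `(2,1,1)^k` family: points `cᵢ` and pairs `{xᵢ, yᵢ}` (`xᵢ ≠ yᵢ`) such that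
`xᵢ + cᵢ − cⱼ` and `yᵢ + cᵢ − cⱼ` avoid `{x_l, y_l}` for every index triple except `i = j = l`
(the instances `j = i ≠ l` say the `2k` points are pairwise distinct; `l = j ≠ i` say the pairs `Aᵢ = {xᵢ + cᵢ, yᵢ + cᵢ}` are disjoint).
[cite: CohnKleinbergSzegedyUmans2005, Def. 5.1] -/
def ShiftPairs211 (x y c : Fin k → H) : Prop :=
  (∀ i, x i ≠ y i) ∧
    ∀ i j l : Fin k, ¬ (i = j ∧ j = l) →
      x i + c i - c j ≠ x l ∧ x i + c i - c j ≠ y l ∧ y i + c i - c j ≠ x l ∧ y i + c i - c j ≠ y l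

/-- Rearrangement used in both directions: `(u + cᵢ) − (v + c_l) = cⱼ − c_l ↔ u + cᵢ − cⱼ = v`. [folklore] -/
theorem sub_shift_eq_iff (u v ci cj cl : H) : (u + ci) - (v + cl) = cj - cl ↔ u + ci - cj = v := by
  constructor
  · intro h
    have h' : u + ci - cj - v = ((u + ci) - (v + cl)) - (cj - cl) := by abel
    rw [h, sub_self] at h'
    exact sub_eq_zero.mp h'
  · intro h
    rw [← h]
    abel

section Model

variable [DecidableEq H]

/-- **The shifted-pairs model is the difference model** (`exists_isSTPP_211_iff`'s right-hand side) under `pᵢ = xᵢ + cᵢ`, `qᵢ = yᵢ + cᵢ`.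
[cite: CohnKleinbergSzegedyUmans2005, Def. 5.1] -/
theorem shiftPairs211_iff_pairPoint (x y c : Fin k → H) :
    ShiftPairs211 x y c ↔
      ((∀ i, x i + c i ≠ y i + c i) ∧
        (∀ i l : Fin k, i ≠ l → Disjoint ({x i + c i, y i + c i} : Finset H) {x l + c l, y l + c l}) ∧
        (∀ i j l : Fin k, j ≠ l → ∀ u ∈ ({x i + c i, y i + c i} : Finset H), ∀ v ∈ ({x l + c l, y l + c l} : Finset H),
          u - v ≠ c j - c l)) := by
  constructor
  · rintro ⟨hxy, h⟩
    refine ⟨fun i e => hxy i (add_right_cancel e), fun i l hil => ?_, fun i j l hjl u hu v hv e => ?_⟩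
    · have hh := h i l l (fun hh => hil hh.1)
      rw [disjoint_insert_left, disjoint_singleton_left, mem_insert, mem_singleton, mem_insert, mem_singleton]
      refine ⟨?_, ?_⟩
      · rintro (e | e)
        · exact hh.1 (by rw [e]; abel)
        · exact hh.2.1 (by rw [e]; abel)
      · rintro (e | e)
        · exact hh.2.2.1 (by rw [e]; abel)
        · exact hh.2.2.2 (by rw [e]; abel)
    · have hh := h i j l (fun hh => hjl hh.2)
      rw [mem_insert, mem_singleton] at hu hv
      rcases hu with rfl | rfl <;> rcases hv with rfl | rfl
      · exact hh.1 ((sub_shift_eq_iff _ _ _ _ _).mp e)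
      · exact hh.2.1 ((sub_shift_eq_iff _ _ _ _ _).mp e)
      · exact hh.2.2.1 ((sub_shift_eq_iff _ _ _ _ _).mp e)
      · exact hh.2.2.2 ((sub_shift_eq_iff _ _ _ _ _).mp e)
  · rintro ⟨hpq, hD, hX⟩
    refine ⟨fun i e => hpq i (by rw [e]), fun i j l hijl => ?_⟩
    by_cases hjl : j = l
    · subst hjl
      have hij : i ≠ j := fun e => hijl ⟨e, rfl⟩
      have hd := hD i j hij
      rw [disjoint_insert_left, disjoint_singleton_left, mem_insert, mem_singleton, mem_insert, mem_singleton, not_or,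
        not_or] at hd
      refine ⟨fun e => hd.1.1 ?_, fun e => hd.1.2 ?_, fun e => hd.2.1 ?_, fun e => hd.2.2 ?_⟩
      · rw [← e]; abel
      · rw [← e]; abel
      · rw [← e]; abel
      · rw [← e]; abel
    · have hu1 : x i + c i ∈ ({x i + c i, y i + c i} : Finset H) := mem_insert_self _ _
      have hu2 : y i + c i ∈ ({x i + c i, y i + c i} : Finset H) := mem_insert_of_mem (mem_singleton_self _)
      have hv1 : x l + c l ∈ ({x l + c l, y l + c l} : Finset H) := mem_insert_self _ _
      have hv2 : y l + c l ∈ ({x l + c l, y l + c l} : Finset H) := mem_insert_of_mem (mem_singleton_self _)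
      exact ⟨fun e => hX i j l hjl _ hu1 _ hv1 ((sub_shift_eq_iff _ _ _ _ _).mpr e),
        fun e => hX i j l hjl _ hu1 _ hv2 ((sub_shift_eq_iff _ _ _ _ _).mpr e),
        fun e => hX i j l hjl _ hu2 _ hv1 ((sub_shift_eq_iff _ _ _ _ _).mpr e),
        fun e => hX i j l hjl _ hu2 _ hv2 ((sub_shift_eq_iff _ _ _ _ _).mpr e)⟩

/-- **ENGINE γ's model is Def. 5.1: a finite abelian group `H` hosts an STPP family of size pattern `(2,1,1)^k` (CKSU Def. 5.1,
tree `IsSTPP`) iff some `x y c : Fin k → H` satisfy `ShiftPairs211 x y c`.**  (Through `exists_isSTPP_211_iff`: `pᵢ = xᵢ + cᵢ`,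
`qᵢ = yᵢ + cᵢ`; conversely `xᵢ = pᵢ − cᵢ`, `yᵢ = qᵢ − cᵢ`.)  An exhaustive NONE of the engine over its model (modulo the symmetries
below) is therefore a NONE for the pattern; a FOUND is a family. [cite: CohnKleinbergSzegedyUmans2005, Def. 5.1] -/
theorem exists_isSTPP_211_iff_shiftPairs :
    (∃ A B C : Fin k → Finset H, IsSTPP A B C ∧ ∀ i, (A i).card = 2 ∧ (B i).card = 1 ∧ (C i).card = 1) ↔
      ∃ x y c : Fin k → H, ShiftPairs211 x y c := by
  rw [exists_isSTPP_211_iff]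
  constructor
  · rintro ⟨p, q, c, hpq, hD, hX⟩
    refine ⟨fun i => p i - c i, fun i => q i - c i, c, (shiftPairs211_iff_pairPoint _ _ _).mpr ?_⟩
    simp only [sub_add_cancel]
    exact ⟨hpq, hD, hX⟩
  · rintro ⟨x, y, c, h⟩
    exact ⟨fun i => x i + c i, fun i => y i + c i, c, (shiftPairs211_iff_pairPoint x y c).mp h⟩

end Model

/-! ## The symmetries engine γ quotients by -/

namespace ShiftPairs211

/-- Translating all shifted pairs by one element (`0 ∈ X` WLOG). [folklore] -/
theorem add_left {x y c : Fin k → H} (h : ShiftPairs211 x y c) (t : H) :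
    ShiftPairs211 (fun i => x i + t) (fun i => y i + t) c := by
  obtain ⟨hxy, h⟩ := h
  refine ⟨fun i e => hxy i (add_right_cancel e), fun i j l hijl => ?_⟩
  obtain ⟨h1, h2, h3, h4⟩ := h i j l hijl
  have ex : x i + t + c i - c j = (x i + c i - c j) + t := by abel
  have ey : y i + t + c i - c j = (y i + c i - c j) + t := by abel
  rw [ex, ey]
  exact ⟨fun e => h1 (add_right_cancel e), fun e => h2 (add_right_cancel e), fun e => h3 (add_right_cancel e),
    fun e => h4 (add_right_cancel e)⟩

/-- Translating all points `cᵢ` by one element (`0 ∈ C` WLOG): the model only sees the differences `cᵢ − cⱼ`. [folklore] -/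
theorem add_right {x y c : Fin k → H} (h : ShiftPairs211 x y c) (t : H) :
    ShiftPairs211 x y (fun i => c i + t) := by
  obtain ⟨hxy, h⟩ := h
  refine ⟨hxy, fun i j l hijl => ?_⟩
  have e : c i + t - (c j + t) = c i - c j := by abel
  simp only [add_sub_assoc, e]
  simpa only [add_sub_assoc] using h i j l hijl

/-- Applying an injective additive map (an automorphism of `H`, or an embedding into a larger group) to everything. [folklore] -/
theorem map {H' : Type*} [AddCommGroup H'] {x y c : Fin k → H} (h : ShiftPairs211 x y c) (φ : H →+ H')
    (hφ : Function.Injective φ) : ShiftPairs211 (fun i => φ (x i)) (fun i => φ (y i)) (fun i => φ (c i)) := by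
  obtain ⟨hxy, h⟩ := h
  refine ⟨fun i e => hxy i (hφ e), fun i j l hijl => ?_⟩
  obtain ⟨h1, h2, h3, h4⟩ := h i j l hijl
  simp only [← map_add, ← map_sub]
  exact ⟨fun e => h1 (hφ e), fun e => h2 (hφ e), fun e => h3 (hφ e), fun e => h4 (hφ e)⟩

/-- Relabelling the indices by a permutation (the engine treats `C = {cᵢ}` as a SET). [folklore] -/
theorem comp_equiv {x y c : Fin k → H} (h : ShiftPairs211 x y c) (σ : Equiv.Perm (Fin k)) :
    ShiftPairs211 (x ∘ σ) (y ∘ σ) (c ∘ σ) := by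
  obtain ⟨hxy, h⟩ := h
  refine ⟨fun i => hxy (σ i), fun i j l hijl => h (σ i) (σ j) (σ l) ?_⟩
  rintro ⟨e1, e2⟩
  exact hijl ⟨σ.injective e1, σ.injective e2⟩

/-- Swapping the two points of one shifted pair (the engine lists each pair in increasing code order). [folklore] -/
theorem swap_pair {x y c : Fin k → H} (h : ShiftPairs211 x y c) (i₀ : Fin k) :
    ShiftPairs211 (Function.update x i₀ (y i₀)) (Function.update y i₀ (x i₀)) c := by
  classical
  obtain ⟨hxy, h⟩ := h
  refine ⟨fun i => ?_, fun i j l hijl => ?_⟩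
  · by_cases hi : i = i₀
    · subst hi; simpa only [Function.update_self] using (hxy i).symm
    · simpa only [Function.update_of_ne hi] using hxy i
  · obtain ⟨h1, h2, h3, h4⟩ := h i j l hijl
    by_cases hi : i = i₀ <;> by_cases hl : l = i₀
    · subst hi; subst hl
      simp only [Function.update_self]
      exact ⟨h4, h3, h2, h1⟩
    · subst hi
      simp only [Function.update_self, Function.update_of_ne hl]
      exact ⟨h3, h4, h1, h2⟩
    · subst hl
      simp only [Function.update_self, Function.update_of_ne hi]
      exact ⟨h2, h1, h4, h3⟩
    · simp only [Function.update_of_ne hi, Function.update_of_ne hl]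
      exact ⟨h1, h2, h3, h4⟩

end ShiftPairs211

end Summit.MatrixMultiplication.OmegaCensus
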